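import Literature.Analysis.Fourier.HilbertTransformLine
import Literature.Analysis.FluidPDE.GCLMSelfSimilarBlowup
import Mathlib.MeasureTheory.Group.Integral
import HarnessLib

/-!
# The two principal-value forms of the line Hilbert transform agree: `lineHilbert = hilbertTransform`

Topic `Literature/Analysis/Fourier`. The tree carries two spellings of the Hilbert transform on `ℝ` (same kernel, same sign
convention `Hf(x) = π⁻¹ p.v.∫ f(y)/(x−y) dy`, `H sin = −cos`):

* the SPLIT form `Literature.Analysis.FluidPDE.lineHilbert f x = π⁻¹ (∫_{(−1,1)} (f(x−u) − f(x))/u du + ∫_{|u|≥1} f(x−u)/u du)`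
  of `Chen2020DissipativeGCLM.lean` (used by the gCLM files `GCLMSelfSimilarAnsatz`, `GCLMSelfSimilarBlowup`,
  `HuangQinWangWei2024SelfSimilarGCLM`), and
* the SYMMETRIC form `Literature.Analysis.Fourier.hilbertTransform f x = π⁻¹ ∫_{t>0} (f(x−t) − f(x+t))/t dt` of
  `HilbertTransformLine.lean` (which carries the proved closed forms `H[(1+y²)⁻¹]`, `H[y/(1+y²)²]`, the Poisson kernels,
  the moment formula, dilation covariance without hypotheses).

Folding `u ↦ −u` shows they are EQUAL whenever the two split pieces are integrable at the point — exactly the pointwise content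
of `HilbertPVAdmissible` [cite: Grafakos2014, Rmk. 5.1.2 (both split integrals converge absolutely; their sum is the p.v.)]:
`lineHilbert_eq_hilbertTransform`. Consequently every closed form of the symmetric operator is a closed form of `lineHilbert`
(`lineHilbert_eq_hilbertTransform_of_admissible`), and conversely the gCLM solution notion `IsGCLMLineSolution` can be read
with either operator. No new definition.
-/

namespace Literature.Analysis.Fourier

open _root_.MeasureTheory Set Filter
open scoped Real Topology

/-- Reflection of a set integral: if `v ∈ T ↔ −v ∈ S` then `∫_S g = ∫_T g(−v) dv`, and integrability transfers. [folklore] -/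
private theorem setIntegral_reflect {S T : Set ℝ} (hS : MeasurableSet S) (hT : MeasurableSet T)
    (hST : ∀ v, v ∈ T ↔ -v ∈ S) (g : ℝ → ℝ) :
    (∫ u in S, g u = ∫ v in T, g (-v)) ∧ (IntegrableOn g S → IntegrableOn (fun v => g (-v)) T) := by
  have hind : (fun v => S.indicator g (-v)) = T.indicator (fun v => g (-v)) := by
    funext v
    by_cases hv : v ∈ T
    · have : -v ∈ S := (hST v).1 hv
      simp [Set.indicator, hv, this]
    · have : -v ∉ S := fun h => hv ((hST v).2 h)
      simp [Set.indicator, hv, this]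
  refine ⟨?_, fun hg => ?_⟩
  · rw [← integral_indicator hS, ← integral_indicator hT, ← integral_neg_eq_self (S.indicator g) volume, hind]
  · have h1 : Integrable (S.indicator g) := (integrable_indicator_iff hS).2 hg
    have h2 : Integrable (fun v => S.indicator g (-v)) := h1.comp_neg
    rw [hind] at h2
    exact (integrable_indicator_iff hT).1 h2

/-- **The split and the symmetric principal values agree.** If at the point `x` the near piece `(f(x−u) − f(x))/u` is integrable
on `(−1,1)` and the far piece `f(x−u)/u` on `{|u| ≥ 1}` (the two hypotheses of the split form), then
`lineHilbert f x = hilbertTransform f x`. [cite: Grafakos2014, Rmk. 5.1.2 (the split form defines the principal value)] -/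
theorem lineHilbert_eq_hilbertTransform {f : ℝ → ℝ} {x : ℝ}
    (hN : IntegrableOn (fun u => (f (x - u) - f x) / u) (Ioo (-1) 1))
    (hF : IntegrableOn (fun u => f (x - u) / u) {u : ℝ | 1 ≤ |u|}) :
    Literature.Analysis.FluidPDE.lineHilbert f x = hilbertTransform f x := by
  rw [Literature.Analysis.FluidPDE.lineHilbert_def, hilbertTransform]
  congr 1
  set N : ℝ → ℝ := fun u => (f (x - u) - f x) / u with hNdef
  set F : ℝ → ℝ := fun u => f (x - u) / u with hFdef
  set S : ℝ → ℝ := fun t => (f (x - t) - f (x + t)) / t with hSdef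
  -- NEAR PIECE: (−1,1) = (−1,0] ∪ (0,1); reflect (−1,0) onto (0,1); N(u) + N(−u) = S(u)
  have hsplitN : Ioo (-1 : ℝ) 1 = Ioc (-1 : ℝ) 0 ∪ Ioo 0 1 := by
    ext u; simp only [mem_Ioo, mem_union, mem_Ioc]
    constructor
    · rintro ⟨h1, h2⟩
      rcases le_or_gt u 0 with h | h
      · exact Or.inl ⟨h1, h⟩
      · exact Or.inr ⟨h, h2⟩
    · rintro (⟨h1, h2⟩ | ⟨h1, h2⟩) <;> constructor <;> linarith
  have hdisjN : Disjoint (Ioc (-1 : ℝ) 0) (Ioo 0 1) := by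
    rw [Set.disjoint_left]; intro u hu hu'; exact absurd hu'.1 (not_lt.2 hu.2)
  have hN1 : IntegrableOn N (Ioc (-1) 0) := hN.mono_set (by rw [hsplitN]; exact subset_union_left)
  have hN2 : IntegrableOn N (Ioo 0 1) := hN.mono_set (by rw [hsplitN]; exact subset_union_right)
  have hreflN := setIntegral_reflect (S := Ioo (-1 : ℝ) 0) (T := Ioo (0 : ℝ) 1) measurableSet_Ioo measurableSet_Ioo
    (fun v => by simp only [mem_Ioo]; constructor <;> rintro ⟨h1, h2⟩ <;> constructor <;> linarith) N
  have hN1' : IntegrableOn N (Ioo (-1) 0) := hN1.mono_set Ioo_subset_Ioc_self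
  have hN3 : IntegrableOn (fun v => N (-v)) (Ioo 0 1) := hreflN.2 hN1'
  have nearEq : ∫ u in Ioo (-1 : ℝ) 1, N u = ∫ t in Ioo (0 : ℝ) 1, S t := by
    rw [hsplitN, setIntegral_union hdisjN measurableSet_Ioo hN1 hN2,
      setIntegral_congr_set (Ioo_ae_eq_Ioc (μ := volume) (a := (-1 : ℝ)) (b := 0)).symm, hreflN.1,
      ← integral_add hN3 hN2]
    refine setIntegral_congr_fun measurableSet_Ioo fun t ht => ?_
    have ht0 : t ≠ 0 := ne_of_gt ht.1
    simp only [hNdef, hSdef, sub_neg_eq_add]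
    field_simp
    ring
  -- FAR PIECE: {|u| ≥ 1} = (−∞,−1] ∪ [1,∞); reflect (−∞,−1] onto [1,∞); F(u) + F(−u) = S(u)
  have hsplitF : {u : ℝ | 1 ≤ |u|} = Iic (-1) ∪ Ici 1 := by
    ext u; simp only [mem_setOf_eq, mem_union, mem_Iic, mem_Ici, le_abs']
  have hdisjF : Disjoint (Iic (-1 : ℝ)) (Ici 1) := by
    rw [Set.disjoint_left]; intro u hu hu'
    have h1 : u ≤ -1 := hu
    have h2 : 1 ≤ u := hu'
    linarith
  have hF1 : IntegrableOn F (Iic (-1)) := hF.mono_set (by rw [hsplitF]; exact subset_union_left)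
  have hF2 : IntegrableOn F (Ici 1) := hF.mono_set (by rw [hsplitF]; exact subset_union_right)
  have hreflF := setIntegral_reflect (S := Iic (-1 : ℝ)) (T := Ici (1 : ℝ)) measurableSet_Iic measurableSet_Ici
    (fun v => by simp only [mem_Ici, mem_Iic]; constructor <;> intro h <;> linarith) F
  have hF3 : IntegrableOn (fun v => F (-v)) (Ici 1) := hreflF.2 hF1
  have farEq : ∫ u in {u : ℝ | 1 ≤ |u|}, F u = ∫ t in Ici (1 : ℝ), S t := by
    rw [hsplitF, setIntegral_union hdisjF measurableSet_Ici hF1 hF2, hreflF.1, ← integral_add hF3 hF2]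
    refine setIntegral_congr_fun measurableSet_Ici fun t ht => ?_
    have ht0 : t ≠ 0 := by have h1 : (1 : ℝ) ≤ t := ht; linarith
    simp only [hFdef, hSdef, sub_neg_eq_add]
    field_simp
    ring
  -- SUM: (0,1) ∪ [1,∞) = (0,∞)
  have hsplitS : Ioi (0 : ℝ) = Ioo 0 1 ∪ Ici 1 := by
    ext u; simp only [mem_Ioi, mem_union, mem_Ioo, mem_Ici]
    constructor
    · intro h
      rcases lt_or_ge u 1 with h' | h'
      · exact Or.inl ⟨h, h'⟩
      · exact Or.inr h'
    · rintro (⟨h1, _⟩ | h1)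
      · exact h1
      · linarith
  have hdisjS : Disjoint (Ioo (0 : ℝ) 1) (Ici 1) := by
    rw [Set.disjoint_left]; intro u hu hu'
    have h2 : 1 ≤ u := hu'
    exact absurd hu.2 (not_lt.2 h2)
  have hS1 : IntegrableOn S (Ioo 0 1) := by
    refine (hN3.add hN2).congr_fun (fun t ht => ?_) measurableSet_Ioo
    have ht0 : t ≠ 0 := ne_of_gt ht.1
    simp only [hNdef, hSdef, sub_neg_eq_add, Pi.add_apply]
    field_simp
    ring
  have hS2 : IntegrableOn S (Ici 1) := by
    refine (hF3.add hF2).congr_fun (fun t ht => ?_) measurableSet_Ici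
    have ht0 : t ≠ 0 := by have h1 : (1 : ℝ) ≤ t := ht; linarith
    simp only [hFdef, hSdef, sub_neg_eq_add, Pi.add_apply]
    field_simp
    ring
  rw [nearEq, farEq, hsplitS, setIntegral_union hdisjS measurableSet_Ici hS1 hS2]

/-- Under the admissibility side condition of the gCLM files (`HilbertPVAdmissible f`: both split pieces integrable at every point,
any radius) the two operators coincide as functions: `lineHilbert f = hilbertTransform f`. Hence every closed form proved for the
symmetric operator (Poisson pair, double pole, moment formula, dilation covariance) holds verbatim for `lineHilbert`.
[cite: Grafakos2014, Rmk. 5.1.2] -/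
theorem lineHilbert_eq_hilbertTransform_of_admissible {f : ℝ → ℝ}
    (hf : Literature.Analysis.FluidPDE.HilbertPVAdmissible f) :
    Literature.Analysis.FluidPDE.lineHilbert f = hilbertTransform f := by
  funext x
  have h1 := hf.1 x 1 one_pos
  have h2 := hf.2 x 1 one_pos
  exact lineHilbert_eq_hilbertTransform h1 h2

/-! ### Integrability of the symmetric integrand from the split pieces (makes `hilbertTransform_add`,
`hilbertTransform_mul_id` usable on concrete functions) -/

/-- The symmetric integrand `(f(x−t) − f(x+t))/t` is integrable on `(0, ∞)` as soon as the two split pieces are integrable at `x`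
(near piece on `(−1,1)`, far piece on `{|u| ≥ 1}`). [cite: Grafakos2014, Rmk. 5.1.2 (both split integrals converge absolutely)] -/
theorem integrableOn_symmIntegrand {f : ℝ → ℝ} {x : ℝ}
    (hN : IntegrableOn (fun u => (f (x - u) - f x) / u) (Ioo (-1) 1))
    (hF : IntegrableOn (fun u => f (x - u) / u) {u : ℝ | 1 ≤ |u|}) :
    IntegrableOn (fun t => (f (x - t) - f (x + t)) / t) (Ioi 0) := by
  set N : ℝ → ℝ := fun u => (f (x - u) - f x) / u with hNdef
  set F : ℝ → ℝ := fun u => f (x - u) / u with hFdef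
  have hsplitN : Ioo (-1 : ℝ) 1 = Ioc (-1 : ℝ) 0 ∪ Ioo 0 1 := by
    ext u; simp only [mem_Ioo, mem_union, mem_Ioc]
    constructor
    · rintro ⟨h1, h2⟩
      rcases le_or_gt u 0 with h | h
      · exact Or.inl ⟨h1, h⟩
      · exact Or.inr ⟨h, h2⟩
    · rintro (⟨h1, h2⟩ | ⟨h1, h2⟩) <;> constructor <;> linarith
  have hN1 : IntegrableOn N (Ioo (-1) 0) :=
    (hN.mono_set (by rw [hsplitN]; exact subset_union_left)).mono_set Ioo_subset_Ioc_self
  have hN2 : IntegrableOn N (Ioo 0 1) := hN.mono_set (by rw [hsplitN]; exact subset_union_right)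
  have hN3 : IntegrableOn (fun v => N (-v)) (Ioo 0 1) :=
    (setIntegral_reflect (S := Ioo (-1 : ℝ) 0) (T := Ioo (0 : ℝ) 1) measurableSet_Ioo measurableSet_Ioo
      (fun v => by simp only [mem_Ioo]; constructor <;> rintro ⟨h1, h2⟩ <;> constructor <;> linarith) N).2 hN1
  have hsplitF : {u : ℝ | 1 ≤ |u|} = Iic (-1) ∪ Ici 1 := by
    ext u; simp only [mem_setOf_eq, mem_union, mem_Iic, mem_Ici, le_abs']
  have hF1 : IntegrableOn F (Iic (-1)) := hF.mono_set (by rw [hsplitF]; exact subset_union_left)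
  have hF2 : IntegrableOn F (Ici 1) := hF.mono_set (by rw [hsplitF]; exact subset_union_right)
  have hF3 : IntegrableOn (fun v => F (-v)) (Ici 1) :=
    (setIntegral_reflect (S := Iic (-1 : ℝ)) (T := Ici (1 : ℝ)) measurableSet_Iic measurableSet_Ici
      (fun v => by simp only [mem_Ici, mem_Iic]; constructor <;> intro h <;> linarith) F).2 hF1
  have hS1 : IntegrableOn (fun t => (f (x - t) - f (x + t)) / t) (Ioo 0 1) := by
    refine (hN3.add hN2).congr_fun (fun t ht => ?_) measurableSet_Ioo
    have ht0 : t ≠ 0 := ne_of_gt ht.1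
    simp only [hNdef, sub_neg_eq_add, Pi.add_apply]
    field_simp
    ring
  have hS2 : IntegrableOn (fun t => (f (x - t) - f (x + t)) / t) (Ici 1) := by
    refine (hF3.add hF2).congr_fun (fun t ht => ?_) measurableSet_Ici
    have ht0 : t ≠ 0 := by have h1 : (1 : ℝ) ≤ t := ht; linarith
    simp only [hFdef, sub_neg_eq_add, Pi.add_apply]
    field_simp
    ring
  have hsplitS : Ioi (0 : ℝ) = Ioo 0 1 ∪ Ici 1 := by
    ext u; simp only [mem_Ioi, mem_union, mem_Ioo, mem_Ici]
    constructor
    · intro h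
      rcases lt_or_ge u 1 with h' | h'
      · exact Or.inl ⟨h, h'⟩
      · exact Or.inr h'
    · rintro (⟨h1, _⟩ | h1)
      · exact h1
      · linarith
  rw [hsplitS]
  exact hS1.union hS2

/-- For `f ∈ C¹ ∩ L¹` the symmetric integrand is integrable on `(0,∞)` at every point (via `hilbertPVAdmissible_of_contDiff` of the
gCLM files): the hypothesis of `hilbertTransform_add` / `hilbertTransform_mul_id` for such `f`.
[cite: Grafakos2014, Rmk. 5.1.2] -/
theorem integrableOn_symmIntegrand_of_contDiff {f : ℝ → ℝ} (hf : ContDiff ℝ 1 f) (hfi : Integrable f) (x : ℝ) :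
    IntegrableOn (fun t => (f (x - t) - f (x + t)) / t) (Ioi 0) := by
  have hadm := Literature.Analysis.FluidPDE.hilbertPVAdmissible_of_contDiff hf hfi
  exact integrableOn_symmIntegrand (hadm.1 x 1 one_pos) (hadm.2 x 1 one_pos)

/-- Hence for `C¹ ∩ L¹` functions the two operators agree everywhere: `lineHilbert f = hilbertTransform f`. [cite: Grafakos2014, Rmk. 5.1.2] -/
theorem lineHilbert_eq_hilbertTransform_of_contDiff {f : ℝ → ℝ} (hf : ContDiff ℝ 1 f) (hfi : Integrable f) :
    Literature.Analysis.FluidPDE.lineHilbert f = hilbertTransform f :=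
  lineHilbert_eq_hilbertTransform_of_admissible (Literature.Analysis.FluidPDE.hilbertPVAdmissible_of_contDiff hf hfi)

end Literature.Analysis.Fourier
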